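import Mathlib
import Literature.Analysis.PDE.Wave1DDuhamelBound
import Literature.Analysis.PDE.Wave1DFarEnergySourced
import HarnessLib

/-!
# Duhamel bound on the far cone `{x > a + |t|}` for `ψ_tt − ψ_xx + V(x)ψ = F` with zero data

Analysis/PDE support file (everything proved, no definitions). Let `ψ` (`C²`) solve the sourced
1+1 wave equation with continuous `V ≥ 0`, `F`, and have zero Cauchy data on `(a, ∞)` at `t = 0`.
If the sliced source norms admit a continuous majorant `√(∫_{a+τ}^{b−τ} F(τ,·)²) ≤ m(τ)` for all
`0 ≤ τ` and `b` with `a + τ ≤ b − τ`, then for `t ≥ 0`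

  `∫⁻_{x > a+t} (ψ_t² + ψ_x² + Vψ²)(t,·) ≤ ofReal (4 (∫_0^t m)²)`      (`wave1D_farCone_energy_le_of_zero_data`),

the `b → ∞` limit (exhaustion by trapezoids, lower Lebesgue integrals) of the trapezoid Duhamel bound
`Wave1DDuhamelBound.lean`; `…_backward` is the time-reversed statement for `t ≤ 0` on `{x > a − t}`.
Use: comparison of the true Regge–Wheeler evolution with the exact inverse-square evolution on the
null-infinity side of `FixedModeChannels` (route PhotonSphereChannels, stmt-FinalStateConjecture-10048),
where `F = −(V − ℓ(ℓ+1)x⁻²)ψ₀` and `m(τ) ≍ (a+τ)^{-3/2}`. Folklore (domain of dependence + energy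
inequality).
-/

noncomputable section

namespace Literature.Analysis.PDE

open MeasureTheory Set Filter Topology intervalIntegral

variable {V : ℝ → ℝ} {F ψ : ℝ → ℝ → ℝ}

/-- Continuity of the sliced `L²` norm `τ ↦ √(∫_{a+τ}^{b−τ} F(τ,·)²)` of a continuous source.
[folklore] -/
theorem continuous_sqrt_slicedSq (hF : Continuous (Function.uncurry F)) (a b : ℝ) :
    Continuous fun τ => Real.sqrt (∫ x in (a + τ)..(b - τ), F τ x ^ 2) := by
  have hF2 : Continuous (Function.uncurry fun τ x => F τ x ^ 2) := by
    show Continuous fun p : ℝ × ℝ => F p.1 p.2 ^ 2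
    have : Continuous fun p : ℝ × ℝ => F p.1 p.2 := hF
    fun_prop
  have hP := intervalIntegral.continuous_parametric_primitive_of_continuous (μ := volume)
    (a₀ := (0 : ℝ)) hF2
  have c1 : Continuous fun τ : ℝ => ∫ x in (0 : ℝ)..(b - τ), F τ x ^ 2 :=
    hP.comp (continuous_id.prodMk (continuous_const.sub continuous_id))
  have c2 : Continuous fun τ : ℝ => ∫ x in (0 : ℝ)..(a + τ), F τ x ^ 2 :=
    hP.comp (continuous_id.prodMk (continuous_const.add continuous_id))
  have heq : (fun τ => ∫ x in (a + τ)..(b - τ), F τ x ^ 2)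
      = fun τ => (∫ x in (0 : ℝ)..(b - τ), F τ x ^ 2) - ∫ x in (0 : ℝ)..(a + τ), F τ x ^ 2 := by
    funext τ
    have hc : Continuous fun x => F τ x ^ 2 := hF2.comp (continuous_const.prodMk continuous_id)
    exact (integral_interval_sub_left (hc.intervalIntegrable _ _) (hc.intervalIntegrable _ _)).symm
  have hc : Continuous fun τ => ∫ x in (a + τ)..(b - τ), F τ x ^ 2 := by rw [heq]; exact c1.sub c2
  exact Real.continuous_sqrt.comp hc

/-- **Far-cone Duhamel bound, forward in time.** See the module docstring. [folklore] -/
theorem wave1D_farCone_energy_le_of_zero_data (hV : Continuous V) (hV0 : ∀ x, 0 ≤ V x)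
    (hF : Continuous (Function.uncurry F)) (hψ : ContDiff ℝ 2 (Function.uncurry ψ))
    (hsol : ∀ t x, iteratedDeriv 2 (fun τ => ψ τ x) t - iteratedDeriv 2 (ψ t) x + V x * ψ t x
      = F t x)
    {a : ℝ} (hzero : ∀ x ∈ Ioi a, ψ 0 x = 0 ∧ deriv (fun τ => ψ τ x) 0 = 0)
    {m : ℝ → ℝ} (hm : Continuous m)
    (hmb : ∀ τ, 0 ≤ τ → ∀ b, a + τ ≤ b - τ → Real.sqrt (∫ x in (a + τ)..(b - τ), F τ x ^ 2) ≤ m τ)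
    {t : ℝ} (ht : 0 ≤ t) :
    ∫⁻ x in Ioi (a + t), ENNReal.ofReal
        (deriv (fun τ => ψ τ x) t ^ 2 + deriv (ψ t) x ^ 2 + V x * ψ t x ^ 2)
      ≤ ENNReal.ofReal (4 * (∫ τ in (0 : ℝ)..t, m τ) ^ 2) := by
  have hunion : Ioi (a + t) = ⋃ n : ℕ, Ioc (a + t) (a + t + n) := by
    ext x
    simp only [mem_iUnion, mem_Ioc, mem_Ioi]
    constructor
    · intro h
      obtain ⟨n, hn⟩ := exists_nat_gt (x - (a + t))
      exact ⟨n, h, by linarith⟩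
    · rintro ⟨n, h1, _⟩
      exact h1
  have hdir : Directed (· ⊆ ·) fun n : ℕ => Ioc (a + t) (a + t + n) :=
    Monotone.directed_le fun i j hij => Ioc_subset_Ioc le_rfl (by
      have : (i : ℝ) ≤ j := by exact_mod_cast hij
      linarith)
  rw [hunion, setLIntegral_iUnion_of_directed _ hdir]
  refine iSup_le fun n => ?_
  have hn0 : (0 : ℝ) ≤ n := n.cast_nonneg
  -- the trapezoid with base `(a, a + 2t + n)`
  set b : ℝ := a + 2 * t + n with hb
  have hzero' : ∀ x ∈ Ioo a b, ψ 0 x = 0 ∧ deriv (fun τ => ψ τ x) 0 = 0 :=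
    fun x hx => hzero x hx.1
  have hD := wave1D_trapezoid_energy_le_of_zero_data hV hV0 hF hψ hsol hzero' ht
    (by simp only [hb]; linarith)
  have htop : b - t = a + t + n := by simp only [hb]; ring
  rw [htop] at hD
  rw [lintegral_Ioc_wave1D_energy_eq hV hV0 hψ t (by linarith)]
  refine ENNReal.ofReal_le_ofReal (hD.trans ?_)
  -- compare the source integrals
  set k : ℝ → ℝ := fun τ => Real.sqrt (∫ x in (a + τ)..(b - τ), F τ x ^ 2) with hk
  have hkc : Continuous k := continuous_sqrt_slicedSq hF a b
  have hk0 : ∀ τ, 0 ≤ k τ := fun τ => Real.sqrt_nonneg _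
  have hkm : ∀ τ ∈ Icc 0 t, k τ ≤ m τ := fun τ hτ =>
    hmb τ hτ.1 b (by simp only [hb]; linarith [hτ.2])
  have hint : ∫ τ in (0 : ℝ)..t, k τ ≤ ∫ τ in (0 : ℝ)..t, m τ :=
    intervalIntegral.integral_mono_on ht (hkc.intervalIntegrable _ _) (hm.intervalIntegrable _ _) hkm
  have hint0 : 0 ≤ ∫ τ in (0 : ℝ)..t, k τ := intervalIntegral.integral_nonneg ht fun τ _ => hk0 τ
  have hsq : (∫ τ in (0 : ℝ)..t, k τ) ^ 2 ≤ (∫ τ in (0 : ℝ)..t, m τ) ^ 2 :=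
    pow_le_pow_left₀ hint0 hint 2
  linarith

/-- **Far-cone Duhamel bound, backward in time** (`t ≤ 0`, cone `{x > a − t}`; the majorant is
assumed for the slices `∫_{a−τ}^{b+τ}` at times `τ ≤ 0`). [folklore] -/
theorem wave1D_farCone_energy_le_of_zero_data_backward (hV : Continuous V) (hV0 : ∀ x, 0 ≤ V x)
    (hF : Continuous (Function.uncurry F)) (hψ : ContDiff ℝ 2 (Function.uncurry ψ))
    (hsol : ∀ t x, iteratedDeriv 2 (fun τ => ψ τ x) t - iteratedDeriv 2 (ψ t) x + V x * ψ t x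
      = F t x)
    {a : ℝ} (hzero : ∀ x ∈ Ioi a, ψ 0 x = 0 ∧ deriv (fun τ => ψ τ x) 0 = 0)
    {m : ℝ → ℝ} (hm : Continuous m)
    (hmb : ∀ τ, τ ≤ 0 → ∀ b, a - τ ≤ b + τ → Real.sqrt (∫ x in (a - τ)..(b + τ), F τ x ^ 2) ≤ m τ)
    {t : ℝ} (ht : t ≤ 0) :
    ∫⁻ x in Ioi (a - t), ENNReal.ofReal
        (deriv (fun τ => ψ τ x) t ^ 2 + deriv (ψ t) x ^ 2 + V x * ψ t x ^ 2)
      ≤ ENNReal.ofReal (4 * (∫ τ in t..(0 : ℝ), m τ) ^ 2) := by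
  obtain ⟨hψ', hsol', he'⟩ := wave1D_timeReversal_source hψ hsol
  have hF' : Continuous (Function.uncurry fun t x => F (-t) x) := by
    have : (Function.uncurry fun t x => F (-t) x)
        = Function.uncurry F ∘ fun p : ℝ × ℝ => (-p.1, p.2) := by
      funext p; rfl
    rw [this]; exact hF.comp (continuous_neg.prodMap continuous_id)
  -- zero data and majorant for the reversed problem
  have hzero' : ∀ x ∈ Ioi a, (fun t x => ψ (-t) x) 0 x = 0 ∧
      deriv (fun τ => (fun t x => ψ (-t) x) τ x) 0 = 0 := by
    intro x hx
    obtain ⟨h0, h1⟩ := hzero x hx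
    refine ⟨by simpa using h0, ?_⟩
    show deriv (fun τ => ψ (-τ) x) 0 = 0
    rw [deriv_comp_neg (fun τ => ψ τ x) 0, neg_zero, h1, neg_zero]
  have hm' : Continuous fun τ => m (-τ) := hm.comp continuous_neg
  have hmb' : ∀ τ, 0 ≤ τ → ∀ b, a + τ ≤ b - τ →
      Real.sqrt (∫ x in (a + τ)..(b - τ), (fun t x => F (-t) x) τ x ^ 2) ≤ m (-τ) := by
    intro τ hτ b hb
    have h := hmb (-τ) (by linarith) b (by linarith)
    simp only [sub_neg_eq_add, ← sub_eq_add_neg] at h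
    simpa using h
  have h := wave1D_farCone_energy_le_of_zero_data hV hV0 hF' hψ' hsol' hzero' hm' hmb'
    (t := -t) (by linarith)
  simp only [he', neg_neg] at h
  have hint : ∫ τ in (0 : ℝ)..(-t), m (-τ) = ∫ τ in t..(0 : ℝ), m τ := by
    rw [intervalIntegral.integral_comp_neg (fun τ => m τ)]
    simp
  rw [hint] at h
  simpa [sub_eq_add_neg] using h

end Literature.Analysis.PDE
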